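import Summits.BirchSwinnertonDyer.BirchSwinnertonDyer.Theorems.QuadraticBranchSignedControlPlusEtaNonsurjThetaFunctionalEquationReciprocity
import HarnessLib

/-!
# Route `QuadraticBranchSignedControl` (rung K8, cell `bsd-potss`), residual crux `PlusEtaMainConjectureNonsurj`
# (stmt-BirchSwinnertonDyer-19606): THE FUNCTIONAL EQUATION ON THE QUADRATIC BRANCH, XVII — SHAPES FORCED BY RECIPROCITY: `T^r` STRIPS OFF
# WITH SIGN `(−1)^r`; `λ = ord_T + 2 ⇒ P = T^r·(T² + aT + a)`; THE TWO EXTRA ZEROS OF THE 19601 SQUEEZE SHAPE ARE PARTNERS,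
# `(1 + c₁)(1 + c₂) = 1` (seat `bsd-potss-k8eta-c2` g29; kernel, class-wide)

WHY. Part XVI proved that the Weierstrass polynomial `P` of every branch function `L_p^±(V, η, X)` is `w`-RECIPROCAL in `1+T`:
`(1+T)^d · ι P = w · P`, `P(−1) = w`. THIS FILE draws the SHAPES: (§39) a factor `T^r` strips off with sign `(−1)^r` — if `P = T^r·Q` then
`(1+T)^{d−r} · ι Q = (−1)^r w · Q` (`ι T · (1+T) = −T`); (§40) a reciprocal MONIC QUADRATIC has EQUAL lower coefficients: `Q(−1) = 1 − q₁ + q₀ =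
(−1)^r w = ±1` and `q₀, q₁ ∈ pℤ_p` force `(−1)^r w = 1` and **`q₁ = q₀`, `Q = T² + aT + a`** — ONE `p`-adic parameter instead of two; (§41) in
the currency of k8eta-c1's functional-equation squeeze for crux 19601 (`…PlusEtaLowerInclusionFunctionalEquationSqueeze`, hypothesis
`hshape`: `Lη = u · T^r · (T − c₁)(T − c₂)`, `u ∈ Λˣ`, `c_i ∈ pℤ_p`): the exact functional equation alone forces **`(1 + c₁)(1 + c₂) = 1`**
(equivalently `c₁c₂ = −(c₁ + c₂)`; `c₂ = c₁^ι` is the PARTNER of `c₁`, Parts XIII/XV) and `w = (−1)^r` — so the per-pair display of that road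
needs ONE root: the second is `(1 + c₁)⁻¹ − 1` (k8eta-c2 g28 NEXT (1) "halve the two-extra-zeros hypothesis", done at the level of a
theorem about the shape; the squeeze itself, B. D. Kim's Thm. 3.11 and the per-pair inputs are k8eta-c1's and untouched). (§42) The
reciprocity is an identity of POLYNOMIALS, so it can be evaluated ANYWHERE: **`(1+α)^d·P(α^ι) = w·P(α)` for every partner pair
`(1+α)(1+α^ι) = 1` in ANY commutative `ℤ_p`-algebra** — the roots of the Weierstrass polynomial of `L_p^±(V, η, X)` in `ℂ_p` (= ALL zeros of
the branch function in the open unit disc), in `𝓞_K`, in residue rings, pair up under `α ↦ (1+α)⁻¹ − 1` (Parts XIII/XV had the `ℚ_p`-rational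
zeros only). (§43) On the quadratic branch: every `L_p^±(V, η, X)`, any `ϖ`, rows.

WHAT. §39 `neg_X_pow_eq`, `coe_X_pow_mul`, **`reciprocal_of_X_pow_mul`**; §40 `eval_neg_one_monic_two`, **`coeff_one_eq_coeff_zero_of_reciprocal_two`**,
`eq_X_sq_add_of_reciprocal_two` (`Q = T² + aT + a`); §41 `isDistinguishedAt_X_pow_mul_X_sub_C_mul_X_sub_C`,
**`partners_of_invol_eq_of_shape`** (`(1+c₁)(1+c₂) = 1 ∧ w = (−1)^r`), `mul_eq_neg_add_of_invol_eq_of_shape`; §42 `C_mul_eq_sum_of_reciprocal`,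
**`aeval_partner_eq_of_reciprocal`** (`(1+α)^d P(α^ι) = w P(α)` in ANY commutative `ℤ_p`-algebra), `aeval_eq_zero_iff_of_reciprocal`; §43
`partners_of_isQuadraticBranch{Plus,Minus}LFunction_of_shape`, `aeval_eq_zero_iff_of_isQuadraticBranchPlusLFunction` (roots of the Weierstrass polynomial pair up in `ℂ_p`, `𝓞_K`, …), rows `partners_of_shape_plus_row` (19601's `hshape` binders), `partner_eq_of_shape_plus_row`
(`c₂ = c₁^ι`), `coeff_one_eq_coeff_zero_plus_row` (`λ = r + 2` data `a·T^r·Q·U`).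

HONEST FRAMING (cell `bsd-potss`; FULL-BSD rank ≤ 1 programme, HUMAN RULING D-0036/D-0074): TOOL THEOREMS ONLY — no definition, no named
fact, no `sorry`, axioms standard; nothing about (A), (C1⁺_η), (E⁺_η), C-cc-1 or `BSD(W,p)` of any pair is claimed; no stub of 19606 (or
19601) is proved; crux and route OPEN; nothing booked. `--supports stmt-BirchSwinnertonDyer-19606`.

References: [MazurTateTeitelbaum1986Invent] §I.17; [GreenbergLNM1716] §5 (p. 181: the root pairing); [Washington1997] §7.1, §13.2;
[KimBD2008MRL] Thm. 3.11 (the algebraic half of the squeeze, not used here); [Kobayashi2003] Thm. 3.2. Tree: Parts X, XIII, XV, XVI;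
`…PlusEtaLowerInclusionFunctionalEquationSqueeze` (k8eta-c1 g11, the `hshape` currency).
-/

set_option autoImplicit false
set_option linter.dupNamespace false
noncomputable section

open scoped Classical MatrixGroups ModularForm

open CongruenceSubgroup WeierstrassCurve Literature.NumberTheory.EllipticCurves
  Literature.NumberTheory.EllipticCurves.ModularForms
open Literature.NumberTheory.EllipticCurves.IwasawaAlgebra
open Summit.BirchSwinnertonDyer.Rank1Residual.Additive

namespace Summit.BirchSwinnertonDyer.BirchSwinnertonDyer.Theorems.EtaThetaFunctionalEquation

variable {p : ℕ} [hp : Fact p.Prime]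

/-! ## §39 Stripping `T^r`: `P = T^r·Q` reciprocal with sign `w` ⇒ `Q` reciprocal with sign `(−1)^r w` -/

omit hp in
/-- `(−T)^r = C((−1)^r)·T^r` in `Λ`. [folklore] -/
theorem neg_X_pow_eq [Fact p.Prime] (r : ℕ) :
    (-PowerSeries.X : IwasawaAlgebra p) ^ r = PowerSeries.C ((-1 : ℤ_[p]) ^ r) * PowerSeries.X ^ r := by
  rw [PowerSeries.C.map_pow, ← mul_pow, map_neg, map_one, neg_one_mul]

omit hp in
/-- `↑(X^r · Q) = T^r · ↑Q` in `Λ`. [folklore] -/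
theorem coe_X_pow_mul [Fact p.Prime] (r : ℕ) (Q : Polynomial ℤ_[p]) :
    ((Polynomial.X ^ r * Q : Polynomial ℤ_[p]) : IwasawaAlgebra p) = PowerSeries.X ^ r * (Q : IwasawaAlgebra p) := by
  rw [Polynomial.coe_mul, Polynomial.coe_pow, Polynomial.coe_X]

/-- **STRIPPING `T^r`.** If `(1+T)^{r+d'} · ι(T^r Q) = w · T^r Q` then `(1+T)^{d'} · ι Q = (−1)^r w · Q`: the factor `T` is self-paired with
sign `−1` (`(1+T)·ι T = −T`). [cite: MazurTateTeitelbaum1986Invent, §I.17] [cite: Washington1997, §13.2] -/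
theorem reciprocal_of_X_pow_mul {Q : Polynomial ℤ_[p]} {r d' : ℕ} {w : ℤ_[p]}
    (h : (1 + PowerSeries.X) ^ (r + d') * invol p ((Polynomial.X ^ r * Q : Polynomial ℤ_[p]) : IwasawaAlgebra p) =
      PowerSeries.C w * ((Polynomial.X ^ r * Q : Polynomial ℤ_[p]) : IwasawaAlgebra p)) :
    (1 + PowerSeries.X) ^ d' * invol p (Q : IwasawaAlgebra p) = PowerSeries.C ((-1) ^ r * w) * (Q : IwasawaAlgebra p) := by
  rw [coe_X_pow_mul, map_mul (invol p), map_pow, pow_add] at h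
  have h1 : PowerSeries.X ^ r * (PowerSeries.C ((-1 : ℤ_[p]) ^ r) * ((1 + PowerSeries.X) ^ d' * invol p (Q : IwasawaAlgebra p))) =
      PowerSeries.X ^ r * (PowerSeries.C w * (Q : IwasawaAlgebra p)) := by
    rw [show PowerSeries.X ^ r * (PowerSeries.C w * (Q : IwasawaAlgebra p)) =
      PowerSeries.C w * (PowerSeries.X ^ r * (Q : IwasawaAlgebra p)) by ring, ← h]
    calc PowerSeries.X ^ r * (PowerSeries.C ((-1 : ℤ_[p]) ^ r) * ((1 + PowerSeries.X) ^ d' * invol p (Q : IwasawaAlgebra p)))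
        = (-PowerSeries.X) ^ r * ((1 + PowerSeries.X) ^ d' * invol p (Q : IwasawaAlgebra p)) := by rw [neg_X_pow_eq]; ring
      _ = (invol p PowerSeries.X ^ r * (1 + PowerSeries.X) ^ r) * ((1 + PowerSeries.X) ^ d' * invol p (Q : IwasawaAlgebra p)) := by
          rw [invol_X_pow_mul_one_add_X_pow]
      _ = (1 + PowerSeries.X) ^ r * (1 + PowerSeries.X) ^ d' * (invol p PowerSeries.X ^ r * invol p (Q : IwasawaAlgebra p)) := by
          ring
  have h2 := PowerSeries.X_pow_mul_injective h1
  have hsq : PowerSeries.C ((-1 : ℤ_[p]) ^ r) * PowerSeries.C ((-1 : ℤ_[p]) ^ r) = (1 : IwasawaAlgebra p) := by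
    rw [← map_mul, ← mul_pow, neg_one_mul, neg_neg, one_pow, map_one]
  calc (1 + PowerSeries.X) ^ d' * invol p (Q : IwasawaAlgebra p)
      = PowerSeries.C ((-1 : ℤ_[p]) ^ r) * (PowerSeries.C ((-1 : ℤ_[p]) ^ r) *
          ((1 + PowerSeries.X) ^ d' * invol p (Q : IwasawaAlgebra p))) := by rw [← mul_assoc, hsq, one_mul]
    _ = PowerSeries.C ((-1) ^ r * w) * (Q : IwasawaAlgebra p) := by rw [h2, map_mul]; ring

/-! ## §40 A reciprocal monic quadratic with lower coefficients in `pℤ_p` is `T² + aT + a` -/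

omit hp in
/-- `Q(−1) = 1 − q₁ + q₀` for a monic quadratic `Q`. [folklore] -/
theorem eval_neg_one_monic_two [Fact p.Prime] {Q : Polynomial ℤ_[p]} (hmon : Q.Monic) (hdeg : Q.natDegree = 2) :
    Q.eval (-1) = 1 - Q.coeff 1 + Q.coeff 0 := by
  rw [Polynomial.eval_eq_sum_range, hdeg]
  have h2 : Q.coeff 2 = 1 := by rw [← hdeg]; exact hmon.coeff_natDegree
  simp only [Finset.sum_range_succ, Finset.sum_range_zero, h2]
  ring

/-- **`q₁ = q₀`**: a monic quadratic `Q = T² + q₁T + q₀` with `q₀, q₁ ∈ pℤ_p` (`p` odd) and `Q(−1) = ±1` has `Q(−1) = 1` and `q₁ = q₀`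
(`Q(−1) = 1 − q₁ + q₀` is a principal unit). [cite: MazurTateTeitelbaum1986Invent, §I.17] [cite: Washington1997, §7.1] -/
theorem coeff_one_eq_coeff_zero_of_reciprocal_two (hp2 : p ≠ 2) {Q : Polynomial ℤ_[p]}
    (hQ : Q.IsDistinguishedAt (IsLocalRing.maximalIdeal ℤ_[p])) (hdeg : Q.natDegree = 2) {w' : ℤ_[p]} (hw : w' = 1 ∨ w' = -1)
    (hev : Q.eval (-1) = w') : Q.coeff 1 = Q.coeff 0 ∧ w' = 1 := by
  have hlow : ∀ i, i < 2 → (p : ℤ_[p]) ∣ Q.coeff i := fun i hi ↦ by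
    rw [← Ideal.mem_span_singleton, ← PadicInt.maximalIdeal_eq_span_p]; exact hQ.mem (by omega)
  have hQ1 := eval_neg_one_monic_two hQ.monic hdeg
  have hnorm : ‖w' - 1‖ < 1 := by
    rw [← hev, hQ1, show (1 : ℤ_[p]) - Q.coeff 1 + Q.coeff 0 - 1 = Q.coeff 0 - Q.coeff 1 by ring]
    exact (PadicInt.norm_lt_one_iff_dvd _).mpr ((hlow 0 (by omega)).sub (hlow 1 (by omega)))
  have hw1 : w' = 1 := eq_one_of_norm_sub_one_lt hp2 hnorm hw
  refine ⟨?_, hw1⟩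
  rw [hw1, hQ1] at hev
  linear_combination -hev

/-- **`Q = T² + aT + a`** (`a = q₀ ∈ pℤ_p`) under the same hypotheses. [cite: MazurTateTeitelbaum1986Invent, §I.17] [cite: Washington1997, §7.1] -/
theorem eq_X_sq_add_of_reciprocal_two (hp2 : p ≠ 2) {Q : Polynomial ℤ_[p]}
    (hQ : Q.IsDistinguishedAt (IsLocalRing.maximalIdeal ℤ_[p])) (hdeg : Q.natDegree = 2) {w' : ℤ_[p]} (hw : w' = 1 ∨ w' = -1)
    (hev : Q.eval (-1) = w') :
    Q = Polynomial.X ^ 2 + Polynomial.C (Q.coeff 0) * Polynomial.X + Polynomial.C (Q.coeff 0) ∧ (p : ℤ_[p]) ∣ Q.coeff 0 := by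
  obtain ⟨h10, -⟩ := coeff_one_eq_coeff_zero_of_reciprocal_two hp2 hQ hdeg hw hev
  refine ⟨?_, ?_⟩
  · conv_lhs => rw [hQ.monic.as_sum, hdeg]
    simp only [Finset.sum_range_succ, Finset.sum_range_zero, zero_add, pow_zero, mul_one, pow_one, h10]
    ring
  · rw [← Ideal.mem_span_singleton, ← PadicInt.maximalIdeal_eq_span_p]; exact hQ.mem (by omega)

/-! ## §41 The 19601 squeeze shape `L = u·T^r·(T − c₁)(T − c₂)`: the exact functional equation makes `c₁, c₂` PARTNERS -/

/-- `T^r·(T − c₁)(T − c₂)` with `c₁, c₂ ∈ pℤ_p` is distinguished of degree `r + 2`. [cite: Washington1997, §7.1] -/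
theorem isDistinguishedAt_X_pow_mul_X_sub_C_mul_X_sub_C (r : ℕ) {c₁ c₂ : ℤ_[p]} (hc₁ : (p : ℤ_[p]) ∣ c₁) (hc₂ : (p : ℤ_[p]) ∣ c₂) :
    (Polynomial.X ^ r * ((Polynomial.X - Polynomial.C c₁) * (Polynomial.X - Polynomial.C c₂))).IsDistinguishedAt
        (IsLocalRing.maximalIdeal ℤ_[p]) ∧
      (Polynomial.X ^ r * ((Polynomial.X - Polynomial.C c₁) * (Polynomial.X - Polynomial.C c₂))).natDegree = r + 2 := by
  set Q : Polynomial ℤ_[p] := (Polynomial.X - Polynomial.C c₁) * (Polynomial.X - Polynomial.C c₂) with hQdef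
  have hQmon : Q.Monic := (Polynomial.monic_X_sub_C c₁).mul (Polynomial.monic_X_sub_C c₂)
  have hQdeg : Q.natDegree = 2 := by
    rw [hQdef, (Polynomial.monic_X_sub_C c₁).natDegree_mul (Polynomial.monic_X_sub_C c₂), Polynomial.natDegree_X_sub_C,
      Polynomial.natDegree_X_sub_C]
  have hQexp : Q = Polynomial.X ^ 2 + Polynomial.C (-(c₁ + c₂)) * Polynomial.X + Polynomial.C (c₁ * c₂) := by
    rw [hQdef, map_neg, map_add, map_mul]; ring
  have hQcoeff : ∀ n, Q.coeff n = if n = 2 then 1 else if n = 1 then -(c₁ + c₂) else if n = 0 then c₁ * c₂ else 0 := by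
    intro n
    rw [hQexp, Polynomial.coeff_add, Polynomial.coeff_add, Polynomial.coeff_X_pow, Polynomial.coeff_C_mul_X, Polynomial.coeff_C]
    split_ifs <;> first | omega | ring
  have hPmon : (Polynomial.X ^ r * Q).Monic := (Polynomial.monic_X_pow r).mul hQmon
  have hPdeg : (Polynomial.X ^ r * Q).natDegree = r + 2 := by
    rw [(Polynomial.monic_X_pow r).natDegree_mul hQmon, Polynomial.natDegree_X_pow, hQdeg]
  refine ⟨{ monic := hPmon, mem := fun {n} hn => ?_ }, hPdeg⟩
  rw [hPdeg] at hn
  rw [PadicInt.maximalIdeal_eq_span_p, Ideal.mem_span_singleton, Polynomial.coeff_X_pow_mul']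
  split_ifs with hrn
  · rw [hQcoeff]
    have h2 : n - r ≠ 2 := by omega
    rw [if_neg h2]
    split_ifs
    · exact (hc₁.add hc₂).neg_right
    · exact hc₁.mul_right _
    · exact dvd_zero _
  · exact dvd_zero _

/-- **THE TWO EXTRA ZEROS ARE PARTNERS.** If `L = u · T^r · (T − c₁)(T − c₂)` with `u ∈ Λˣ`, `c₁, c₂ ∈ pℤ_p` (`p` odd), and `L` satisfies an
exact functional equation `ι L = w·(1+T)^e·L` with `w = ±1`, then **`(1 + c₁)(1 + c₂) = 1`** and `w = (−1)^r`: the cofactor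
`Q = (T − c₁)(T − c₂)` is `(−1)^r w`-reciprocal (Part XVI + §39), so `Q(−1) = (1+c₁)(1+c₂) = (−1)^r w = ±1` is a principal unit, hence `1`.
[cite: GreenbergLNM1716, §5 (p. 181)] [cite: MazurTateTeitelbaum1986Invent, §I.17] [cite: Washington1997, §7.1] -/
theorem partners_of_invol_eq_of_shape (hp2 : p ≠ 2) {u : IwasawaAlgebra p} (hu : IsUnit u) {c₁ c₂ : ℤ_[p]}
    (hc₁ : (p : ℤ_[p]) ∣ c₁) (hc₂ : (p : ℤ_[p]) ∣ c₂) {r : ℕ} {L : IwasawaAlgebra p}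
    (hL : L = u * PowerSeries.X ^ r * ((PowerSeries.X - PowerSeries.C c₁) * (PowerSeries.X - PowerSeries.C c₂)))
    {w e : ℤ_[p]} (hw : w = 1 ∨ w = -1) (hFE : invol p L = PowerSeries.C w * PowerSeries.binomialSeries ℤ_[p] e * L) :
    (1 + c₁) * (1 + c₂) = 1 ∧ w = (-1) ^ r := by
  obtain ⟨hP, hPdeg⟩ := isDistinguishedAt_X_pow_mul_X_sub_C_mul_X_sub_C r hc₁ hc₂
  set Q : Polynomial ℤ_[p] := (Polynomial.X - Polynomial.C c₁) * (Polynomial.X - Polynomial.C c₂) with hQdef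
  have hQmon : Q.Monic := (Polynomial.monic_X_sub_C c₁).mul (Polynomial.monic_X_sub_C c₂)
  have hQdeg : Q.natDegree = 2 := by
    rw [hQdef, (Polynomial.monic_X_sub_C c₁).natDegree_mul (Polynomial.monic_X_sub_C c₂), Polynomial.natDegree_X_sub_C,
      Polynomial.natDegree_X_sub_C]
  have hcoe : ((Polynomial.X ^ r * Q : Polynomial ℤ_[p]) : IwasawaAlgebra p) =
      PowerSeries.X ^ r * ((PowerSeries.X - PowerSeries.C c₁) * (PowerSeries.X - PowerSeries.C c₂)) := by
    rw [coe_X_pow_mul, hQdef, Polynomial.coe_mul, Polynomial.coe_sub, Polynomial.coe_sub, Polynomial.coe_X, Polynomial.coe_C,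
      Polynomial.coe_C]
  have hL' : L = PowerSeries.C 1 * ((Polynomial.X ^ r * Q : Polynomial ℤ_[p]) : IwasawaAlgebra p) * u := by
    rw [map_one, one_mul, hcoe, hL]; ring
  have hrec := one_add_X_pow_mul_invol_coe_eq_of_invol_eq hP one_ne_zero hu hL' hFE
  rw [hPdeg] at hrec
  have hrecQ := reciprocal_of_X_pow_mul hrec
  rw [← hQdeg] at hrecQ
  have hev := eval_neg_one_eq_of_reciprocal hQmon hrecQ
  have hevQ : Q.eval (-1) = (1 + c₁) * (1 + c₂) := by
    rw [hQdef, Polynomial.eval_mul, Polynomial.eval_sub, Polynomial.eval_sub, Polynomial.eval_X, Polynomial.eval_C,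
      Polynomial.eval_C]; ring
  have hw' : (-1 : ℤ_[p]) ^ r * w = 1 ∨ (-1 : ℤ_[p]) ^ r * w = -1 := by
    rcases hw with rfl | rfl <;> rcases neg_one_pow_eq_or ℤ_[p] r with h1 | h1 <;> rw [h1] <;> norm_num
  have hnorm : ‖(1 + c₁) * (1 + c₂) - 1‖ < 1 := by
    rw [show (1 + c₁) * (1 + c₂) - 1 = c₁ + c₂ + c₁ * c₂ by ring]
    exact (PadicInt.norm_lt_one_iff_dvd _).mpr ((hc₁.add hc₂).add (hc₁.mul_right _))
  have h1 : (1 + c₁) * (1 + c₂) = 1 := eq_one_of_norm_sub_one_lt hp2 hnorm (hevQ ▸ hev ▸ hw')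
  refine ⟨h1, ?_⟩
  have h2 : (-1 : ℤ_[p]) ^ r * w = 1 := by rw [← hev, hevQ, h1]
  have hsq : ((-1 : ℤ_[p]) ^ r) * (-1) ^ r = 1 := by rw [← mul_pow, neg_one_mul, neg_neg, one_pow]
  linear_combination (-1 : ℤ_[p]) ^ r * h2 - w * hsq

/-- **`c₁c₂ = −(c₁ + c₂)`** — the same statement in symmetric-function form (the cofactor is `T² + aT + a`, `a = c₁c₂`).
[cite: GreenbergLNM1716, §5 (p. 181)] [cite: MazurTateTeitelbaum1986Invent, §I.17] -/
theorem mul_eq_neg_add_of_invol_eq_of_shape (hp2 : p ≠ 2) {u : IwasawaAlgebra p} (hu : IsUnit u) {c₁ c₂ : ℤ_[p]}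
    (hc₁ : (p : ℤ_[p]) ∣ c₁) (hc₂ : (p : ℤ_[p]) ∣ c₂) {r : ℕ} {L : IwasawaAlgebra p}
    (hL : L = u * PowerSeries.X ^ r * ((PowerSeries.X - PowerSeries.C c₁) * (PowerSeries.X - PowerSeries.C c₂)))
    {w e : ℤ_[p]} (hw : w = 1 ∨ w = -1) (hFE : invol p L = PowerSeries.C w * PowerSeries.binomialSeries ℤ_[p] e * L) :
    c₁ * c₂ = -(c₁ + c₂) := by
  have h := (partners_of_invol_eq_of_shape hp2 hu hc₁ hc₂ hL hw hFE).1
  linear_combination h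

/-! ## §42 The roots of a `w`-reciprocal `P` in ANY commutative `ℤ_p`-algebra come in `ι`-pairs (`ℂ_p`, `𝓞_K`, …) -/

/-- The reciprocity `(1+T)^d ι P = w P` as an identity of POLYNOMIALS: `w·P = Σ_k p_k(−1)^k (1+X)^{d−k} X^k` in `ℤ_p[X]` (the coercion
`ℤ_p[X] → Λ` is injective). [cite: Washington1997, §13.2] -/
theorem C_mul_eq_sum_of_reciprocal {P : Polynomial ℤ_[p]} {w : ℤ_[p]}
    (h : (1 + PowerSeries.X) ^ P.natDegree * invol p (P : IwasawaAlgebra p) = PowerSeries.C w * (P : IwasawaAlgebra p)) :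
    Polynomial.C w * P = ∑ k ∈ Finset.range (P.natDegree + 1),
      Polynomial.C (P.coeff k * (-1) ^ k) * ((1 + Polynomial.X) ^ (P.natDegree - k) * Polynomial.X ^ k) := by
  apply Polynomial.coe_injective
  rw [Polynomial.coe_mul, Polynomial.coe_C, ← h, one_add_X_pow_mul_invol_coe_eq_sum,
    show ((∑ k ∈ Finset.range (P.natDegree + 1), Polynomial.C (P.coeff k * (-1) ^ k) *
        ((1 + Polynomial.X) ^ (P.natDegree - k) * Polynomial.X ^ k) : Polynomial ℤ_[p]) : IwasawaAlgebra p) =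
      Polynomial.coeToPowerSeries.ringHom (∑ k ∈ Finset.range (P.natDegree + 1), Polynomial.C (P.coeff k * (-1) ^ k) *
        ((1 + Polynomial.X) ^ (P.natDegree - k) * Polynomial.X ^ k)) from rfl, map_sum]
  refine Finset.sum_congr rfl fun k _ => ?_
  rw [Polynomial.coeToPowerSeries.ringHom_apply, Polynomial.coe_mul, Polynomial.coe_mul, Polynomial.coe_pow, Polynomial.coe_pow,
    Polynomial.coe_C, Polynomial.coe_add, Polynomial.coe_one, Polynomial.coe_X]

/-- **`(1+α)^d · P(α^ι) = w · P(α)` IN ANY COMMUTATIVE `ℤ_p`-ALGEBRA `A`** (`ℂ_p`, `𝓞_K`, a residue ring, …): for a `w`-reciprocal `P` of degree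
`d` and every pair `(1+α)(1+α') = 1` in `A` (so `(1+α)·α' = −α`). Purely algebraic: `P` is a polynomial, no convergence is involved.
[cite: GreenbergLNM1716, §5 (p. 181: the root pairing a ↔ (1+a)⁻¹ − 1)] [cite: MazurTateTeitelbaum1986Invent, §I.17] -/
theorem aeval_partner_eq_of_reciprocal {P : Polynomial ℤ_[p]} {w : ℤ_[p]}
    (h : (1 + PowerSeries.X) ^ P.natDegree * invol p (P : IwasawaAlgebra p) = PowerSeries.C w * (P : IwasawaAlgebra p))
    {A : Type*} [CommRing A] [Algebra ℤ_[p] A] {α α' : A} (hαα : (1 + α) * (1 + α') = 1) :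
    (1 + α) ^ P.natDegree * Polynomial.aeval α' P = algebraMap ℤ_[p] A w * Polynomial.aeval α P := by
  have hkey : (1 + α) * α' = -α := by linear_combination hαα
  have hR := congr_arg (Polynomial.aeval α) (C_mul_eq_sum_of_reciprocal h)
  rw [map_mul, Polynomial.aeval_C, map_sum] at hR
  rw [hR, Polynomial.aeval_eq_sum_range, Finset.mul_sum]
  refine Finset.sum_congr rfl fun k hk => ?_
  have hkd : k ≤ P.natDegree := Nat.lt_succ_iff.mp (Finset.mem_range.mp hk)
  rw [map_mul, Polynomial.aeval_C, map_mul (Polynomial.aeval α), map_pow (Polynomial.aeval α), map_pow (Polynomial.aeval α),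
    map_add, map_one, Polynomial.aeval_X, Algebra.smul_def, map_mul (algebraMap ℤ_[p] A), map_pow (algebraMap ℤ_[p] A), map_neg,
    map_one]
  calc (1 + α) ^ P.natDegree * (algebraMap ℤ_[p] A (P.coeff k) * α' ^ k)
      = algebraMap ℤ_[p] A (P.coeff k) * (1 + α) ^ (P.natDegree - k) * ((1 + α) * α') ^ k := by
        rw [← Nat.sub_add_cancel hkd, pow_add, Nat.add_sub_cancel, mul_pow]; ring
    _ = algebraMap ℤ_[p] A (P.coeff k) * (-1) ^ k * ((1 + α) ^ (P.natDegree - k) * α ^ k) := by rw [hkey, neg_pow]; ring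

/-- **THE ROOTS OF A `w`-RECIPROCAL `P` PAIR UP IN ANY `ℤ_p`-ALGEBRA**: `(1+α)(1+α') = 1` ⇒ (`P(α) = 0 ⟺ P(α') = 0`) (any `w`). With Part
XVI this covers ALL zeros of `L_p^±(V, η, X)` in the open unit disc of `ℂ_p` (they are the roots of its Weierstrass polynomial; a unit of `Λ`
has no zeros there), not only the `ℚ_p`-rational ones of Parts XIII/XV. [cite: GreenbergLNM1716, §5 (p. 181)] [cite: MazurTateTeitelbaum1986Invent, §I.17] -/
theorem aeval_eq_zero_iff_of_reciprocal {P : Polynomial ℤ_[p]} {w : ℤ_[p]}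
    (h : (1 + PowerSeries.X) ^ P.natDegree * invol p (P : IwasawaAlgebra p) = PowerSeries.C w * (P : IwasawaAlgebra p))
    {A : Type*} [CommRing A] [Algebra ℤ_[p] A] {α α' : A} (hαα : (1 + α) * (1 + α') = 1) :
    Polynomial.aeval α P = 0 ↔ Polynomial.aeval α' P = 0 := by
  have h1 := aeval_partner_eq_of_reciprocal h hαα
  have h2 := aeval_partner_eq_of_reciprocal h (show (1 + α') * (1 + α) = 1 by rw [mul_comm]; exact hαα)
  constructor
  · intro h0
    rw [h0, mul_zero] at h1
    exact (IsUnit.pow _ (IsUnit.of_mul_eq_one _ hαα)).mul_right_eq_zero.mp h1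
  · intro h0
    rw [h0, mul_zero] at h2
    exact (IsUnit.pow _ (IsUnit.of_mul_eq_one _ (show (1 + α') * (1 + α) = 1 by rw [mul_comm]; exact hαα))).mul_right_eq_zero.mp h2

/-! ## §43 On the quadratic branch -/

section Branch

variable {N : ℕ} [NeZero N] {f : CuspForm (Gamma0 N) 2}

/-- **THE EXTRA ZEROS OF `L_p⁺(V, η, X)` ARE PARTNERS**: `p` odd, `f` a rational newform of level `N` prime to `p` with `a_p(f) = 0`, ANY period
ratio `ϖ`; if a plus branch function has the shape `L = u·T^r·(T − c₁)(T − c₂)` (`u ∈ Λˣ`, `c₁, c₂ ∈ pℤ_p`), then `(1 + c₁)(1 + c₂) = 1`.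
No sign, `μ`, image, CM or rank hypothesis. [cite: GreenbergLNM1716, §5 (p. 181)] [cite: MazurTateTeitelbaum1986Invent, §I.17]
[cite: Kobayashi2003, Thm. 3.2, (3.4)] -/
theorem partners_of_isQuadraticBranchPlusLFunction_of_shape (hp2 : p ≠ 2) (hf0 : IsNewform0 f) (hQ : coeffField f = ⊥)
    (hpN : ¬ p ∣ N) (hap : cuspCoeff f p = ((0 : ℤ) : ℂ)) {ϖ : ℚ} {L : IwasawaAlgebra p}
    (hL : IsQuadraticBranchPlusLFunction f p ϖ L) {u : IwasawaAlgebra p} (hu : IsUnit u) {c₁ c₂ : ℤ_[p]}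
    (hc₁ : (p : ℤ_[p]) ∣ c₁) (hc₂ : (p : ℤ_[p]) ∣ c₂) {r : ℕ}
    (hLs : L = u * PowerSeries.X ^ r * ((PowerSeries.X - PowerSeries.C c₁) * (PowerSeries.X - PowerSeries.C c₂))) :
    (1 + c₁) * (1 + c₂) = 1 := by
  obtain ⟨σ, hσ, hW⟩ := exists_frickeSign_of_isNewform0 hf0
  obtain ⟨e, he⟩ := exists_invol_eq_of_isQuadraticBranchPlusLFunction hp2 hf0 hQ hpN hap hσ hW hL
  have hw : (((σ * legendreSym p (-(N : ℤ)) : ℤ) : ℤ_[p])) = 1 ∨ (((σ * legendreSym p (-(N : ℤ)) : ℤ) : ℤ_[p])) = -1 := by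
    rcases sign_eq_one_or hpN hσ with h | h <;> rw [h] <;> simp
  exact (partners_of_invol_eq_of_shape hp2 hu hc₁ hc₂ hLs hw he).1

/-- **THE EXTRA ZEROS OF `L_p⁻(V, η, X)` ARE PARTNERS** (minus twin). [cite: GreenbergLNM1716, §5 (p. 181)]
[cite: MazurTateTeitelbaum1986Invent, §I.17] [cite: Kobayashi2003, Thm. 3.2, (3.5)] -/
theorem partners_of_isQuadraticBranchMinusLFunction_of_shape (hp2 : p ≠ 2) (hf0 : IsNewform0 f) (hQ : coeffField f = ⊥)
    (hpN : ¬ p ∣ N) (hap : cuspCoeff f p = ((0 : ℤ) : ℂ)) {ϖ : ℚ} {L : IwasawaAlgebra p}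
    (hL : IsQuadraticBranchMinusLFunction f p ϖ L) {u : IwasawaAlgebra p} (hu : IsUnit u) {c₁ c₂ : ℤ_[p]}
    (hc₁ : (p : ℤ_[p]) ∣ c₁) (hc₂ : (p : ℤ_[p]) ∣ c₂) {r : ℕ}
    (hLs : L = u * PowerSeries.X ^ r * ((PowerSeries.X - PowerSeries.C c₁) * (PowerSeries.X - PowerSeries.C c₂))) :
    (1 + c₁) * (1 + c₂) = 1 := by
  obtain ⟨σ, hσ, hW⟩ := exists_frickeSign_of_isNewform0 hf0
  obtain ⟨e, he⟩ := exists_invol_eq_of_isQuadraticBranchMinusLFunction hp2 hf0 hQ hpN hap hσ hW hL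
  have hw : (((σ * legendreSym p (-(N : ℤ)) : ℤ) : ℤ_[p])) = 1 ∨ (((σ * legendreSym p (-(N : ℤ)) : ℤ) : ℤ_[p])) = -1 := by
    rcases sign_eq_one_or hpN hσ with h | h <;> rw [h] <;> simp
  exact (partners_of_invol_eq_of_shape hp2 hu hc₁ hc₂ hLs hw he).1

/-- **THE ROOTS OF THE WEIERSTRASS POLYNOMIAL OF `L_p⁺(V, η, X)` PAIR UP IN ANY `ℤ_p`-ALGEBRA** (`ℂ_p`, `𝓞_K`, …): `p` odd, `f` a rational
newform of level `N` prime to `p`, `a_p(f) = 0`, ANY `ϖ`, every datum `L = a·P·U`, every commutative `ℤ_p`-algebra `A` and pair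
`(1+α)(1+α') = 1` in `A`: `P(α) = 0 ⟺ P(α') = 0`. [cite: GreenbergLNM1716, §5 (p. 181)] [cite: MazurTateTeitelbaum1986Invent, §I.17]
[cite: Kobayashi2003, Thm. 3.2, (3.4)] -/
theorem aeval_eq_zero_iff_of_isQuadraticBranchPlusLFunction (hp2 : p ≠ 2) (hf0 : IsNewform0 f) (hQ : coeffField f = ⊥)
    (hpN : ¬ p ∣ N) (hap : cuspCoeff f p = ((0 : ℤ) : ℂ)) {ϖ : ℚ} {L : IwasawaAlgebra p}
    (hL : IsQuadraticBranchPlusLFunction f p ϖ L) {P : Polynomial ℤ_[p]} (hP : P.IsDistinguishedAt (IsLocalRing.maximalIdeal ℤ_[p]))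
    {a : ℤ_[p]} (ha : a ≠ 0) {U : IwasawaAlgebra p} (hU : IsUnit U) (hLP : L = PowerSeries.C a * (P : IwasawaAlgebra p) * U)
    {A : Type*} [CommRing A] [Algebra ℤ_[p] A] {α α' : A} (hαα : (1 + α) * (1 + α') = 1) :
    Polynomial.aeval α P = 0 ↔ Polynomial.aeval α' P = 0 := by
  obtain ⟨σ, hσ, hW⟩ := exists_frickeSign_of_isNewform0 hf0
  obtain ⟨h1, -⟩ := reciprocal_of_isQuadraticBranchPlusLFunction hp2 hf0 hQ hpN hap hσ hW hL hP ha hU hLP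
  exact aeval_eq_zero_iff_of_reciprocal h1 hαα

end Branch

section Row

variable {N : ℕ} [NeZero N] {f : CuspForm (Gamma0 N) 2}

/-- **AT A ROW (plus), IN THE 19601 `hshape` CURRENCY**: `V` globally minimal, good at `p ≥ 5`, `a_p(V) = 0`, `f` its newform, any `ϖ`, every
plus branch function of the shape `Lη = u·T^r·(T − c₁)(T − c₂)` (`u ∈ Λˣ`, `p ∣ c₁`, `p ∣ c₂`): `(1 + c₁)(1 + c₂) = 1` — the second displayed
zero is the partner `(1 + c₁)⁻¹ − 1` of the first. Hypothesis-free beyond the row data and the shape. [cite: GreenbergLNM1716, §5 (p. 181)]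
[cite: MazurTateTeitelbaum1986Invent, §I.17] -/
theorem partners_of_shape_plus_row (hp5 : 5 ≤ p) (V : WeierstrassCurve ℚ) [V.IsElliptic] [V.IsGloballyMinimal]
    (hgood : V.HasGoodReductionAtPrime p) (hap : V.frobeniusTrace p = 0) (hf : IsNewformOf V f) (ϖ : ℚ) {Lη : IwasawaAlgebra p}
    (hL : IsQuadraticBranchPlusLFunction f p ϖ Lη) {u : IwasawaAlgebra p} (hu : IsUnit u) {c₁ c₂ : ℤ_[p]}
    (hc₁ : (p : ℤ_[p]) ∣ c₁) (hc₂ : (p : ℤ_[p]) ∣ c₂) {r : ℕ}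
    (hLs : Lη = u * PowerSeries.X ^ r * ((PowerSeries.X - PowerSeries.C c₁) * (PowerSeries.X - PowerSeries.C c₂))) :
    (1 + c₁) * (1 + c₂) = 1 := by
  have hp2 : p ≠ 2 := by omega
  have hap' : cuspCoeff f p = ((0 : ℤ) : ℂ) := by
    rw [cuspCoeff_eq_frobeniusTrace_of_isNewformOf_holds hf hgood, hap]
  exact partners_of_isQuadraticBranchPlusLFunction_of_shape hp2 hf.1 hf.coeffField_eq_bot (not_dvd_level_of_isNewformOf hf hgood)
    hap' hL hu hc₁ hc₂ hLs

/-- **AT A ROW (plus): `c₂ = c₁^ι`** — with the partner `c₁'` of `c₁` (`(1+c₁)(1+c₁') = 1`, Part XIII `exists_partner_of_norm_lt_one`), the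
second zero of the shape IS `c₁'`. [cite: GreenbergLNM1716, §5 (p. 181)] [cite: MazurTateTeitelbaum1986Invent, §I.17] -/
theorem partner_eq_of_shape_plus_row (hp5 : 5 ≤ p) (V : WeierstrassCurve ℚ) [V.IsElliptic] [V.IsGloballyMinimal]
    (hgood : V.HasGoodReductionAtPrime p) (hap : V.frobeniusTrace p = 0) (hf : IsNewformOf V f) (ϖ : ℚ) {Lη : IwasawaAlgebra p}
    (hL : IsQuadraticBranchPlusLFunction f p ϖ Lη) {u : IwasawaAlgebra p} (hu : IsUnit u) {c₁ c₂ : ℤ_[p]}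
    (hc₁ : (p : ℤ_[p]) ∣ c₁) (hc₂ : (p : ℤ_[p]) ∣ c₂) {r : ℕ}
    (hLs : Lη = u * PowerSeries.X ^ r * ((PowerSeries.X - PowerSeries.C c₁) * (PowerSeries.X - PowerSeries.C c₂)))
    {c₁' : ℤ_[p]} (hc₁' : (1 + c₁) * (1 + c₁') = 1) : c₂ = c₁' :=
  partner_unique (partners_of_shape_plus_row hp5 V hgood hap hf ϖ hL hu hc₁ hc₂ hLs) hc₁'

/-- **AT A ROW (plus), `λ = r + 2` WITHOUT SPLITTING**: for every datum `Lη = a·(T^r·Q)·U` (`a ≠ 0`, `U ∈ Λˣ`, `T^r·Q` distinguished, `Q` of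
degree `2`, so `λ(Lη) = r + 2`): `q₁ = q₀`, i.e. `Q = T² + q₀T + q₀`. [cite: MazurTateTeitelbaum1986Invent, §I.17] [cite: Washington1997, §7.1] -/
theorem coeff_one_eq_coeff_zero_plus_row (hp5 : 5 ≤ p) (V : WeierstrassCurve ℚ) [V.IsElliptic] [V.IsGloballyMinimal]
    (hgood : V.HasGoodReductionAtPrime p) (hap : V.frobeniusTrace p = 0) (hf : IsNewformOf V f) {σ : ℤ} (hσ : σ ^ 2 = 1)
    (hW : atkinLehnerInvolution N 2 N f = (-(σ : ℂ)) • f) (ϖ : ℚ) {Lη : IwasawaAlgebra p}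
    (hL : IsQuadraticBranchPlusLFunction f p ϖ Lη) {r : ℕ} {Q : Polynomial ℤ_[p]}
    (hP : (Polynomial.X ^ r * Q).IsDistinguishedAt (IsLocalRing.maximalIdeal ℤ_[p]))
    (hQd : Q.IsDistinguishedAt (IsLocalRing.maximalIdeal ℤ_[p])) (hdeg : Q.natDegree = 2)
    {a : ℤ_[p]} (ha : a ≠ 0) {U : IwasawaAlgebra p} (hU : IsUnit U)
    (hLP : Lη = PowerSeries.C a * ((Polynomial.X ^ r * Q : Polynomial ℤ_[p]) : IwasawaAlgebra p) * U) :
    Q.coeff 1 = Q.coeff 0 ∧ Q = Polynomial.X ^ 2 + Polynomial.C (Q.coeff 0) * Polynomial.X + Polynomial.C (Q.coeff 0) := by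
  have hp2 : p ≠ 2 := by omega
  obtain ⟨hrec, -⟩ := reciprocal_plus_row hp5 V hgood hap hf hσ hW ϖ hL hP ha hU hLP
  have hPdeg : (Polynomial.X ^ r * Q).natDegree = r + Q.natDegree := by
    rw [(Polynomial.monic_X_pow r).natDegree_mul hQd.monic, Polynomial.natDegree_X_pow]
  rw [hPdeg] at hrec
  have hrecQ := reciprocal_of_X_pow_mul hrec
  have hev := eval_neg_one_eq_of_reciprocal hQd.monic hrecQ
  have hw : (-1 : ℤ_[p]) ^ r * (((σ * legendreSym p (-(N : ℤ)) : ℤ) : ℤ_[p])) = 1 ∨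
      (-1 : ℤ_[p]) ^ r * (((σ * legendreSym p (-(N : ℤ)) : ℤ) : ℤ_[p])) = -1 := by
    rcases sign_eq_one_or (not_dvd_level_of_isNewformOf hf hgood) hσ with h | h <;> rw [h] <;>
      rcases neg_one_pow_eq_or ℤ_[p] r with h1 | h1 <;> rw [h1] <;> norm_num
  exact ⟨(coeff_one_eq_coeff_zero_of_reciprocal_two hp2 hQd hdeg hw hev).1, (eq_X_sq_add_of_reciprocal_two hp2 hQd hdeg hw hev).1⟩

end Row

end Summit.BirchSwinnertonDyer.BirchSwinnertonDyer.Theorems.EtaThetaFunctionalEquation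

end
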